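import Summits.PneNP.PneNP.Theorems.UniformStreamUniformMagnificationVariants160475
import Summits.PneNP.PneNP.Theorems.UniformStreamUniformMagnificationStubSeed
import HarnessLib

/-!
# Route UniformStream, crux `UniformMagnification` (stmt-PneNP-16047), line `registered`,
# stub `stub_searchStream`: the one-pass compressor for `MCSP[s]` under `NP ⊆ P`

**Theorem** (`stub_searchStream`, McKay–Murray–Williams 2019, Algorithm 1 with block length `1`,
under the collapse). Assume the three clauses of `stub_goodProg` (soundness and completeness of
good programs of the circuit-evaluation machine, and `P`-decidability of goodness), `n ≤ s n`, and
`NP ⊆ P`. Then there are `ι, δ ∈ FP` and `α ∈ P` such that, feeding `ι` the seed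
`⟨⟨tail (bin N), 1^{s ⌊log₂ N⌋}⟩, bin N⟩` of a word `x` of length `N` and folding `δ` over the
bits of `x`, the final state lies in `α` iff `x ∈ MCSP[s]`; the initial state has length
`≤ s(⌊log₂ N⌋)^k + k`; and `δ` never lengthens a state.

Proof (parts A–C: `UniformStreamUniformMagnificationVariants160473/4/5.lean`). `ι = iota π χ g`,
`δ = delta χ g`, `α = HeadIs 1`, where `g` is the Arora–Barak search function (Thm. 2.18) of the
consistency relation `Rel ∈ P` (part A, this is where `NP ⊆ P` is used twice: to put the `coNP`
row test in `P` and to search), `χ = [· ∈ Rel]` and `π = [· ∈ Pow2L]` its indicators. If `N` is not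
a power of two, `ι` answers the dead word `ε`, which `δ` freezes, and `x ∉ MCSP[s]`
(`length_truthTable`). If `N = 2ⁿ`, the run keeps the Nerode invariant (`SearchStream.run_invariant`,
by induction on the prefix `p`, `|p| ≤ 2ⁿ`): the state is either the live word
`liveWord u v |p| D` with `D` a good program of width `≤ W` whose rows `< |p|` spell `p`, or the
dead word and NO function of complexity `≤ s n` extends `p` (parts B, C: `delta` on a live word is
the core step, `SearchStream.core_live_step`; on the dead word it is the dead word). At the end,
a live `D` has truth table `x` (all `2ⁿ` rows, `MCSPVerif.getElem_truthTable`) and complexity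
`≤ s n` by soundness, so `x ∈ MCSP[s]`; conversely `x = tt f ∈ MCSP[s]` makes `f` an extension of
every prefix, so the run never dies. The length of a live word is `2|⟨u,v⟩| + 2n + 2W + 12`,
polynomial in `s n ≥ n` (`mul_succ_pow_add_le_pow_add`), and `δ` is non-lengthening by its guard
(`SearchStream.length_delta_le`).

References: D. M. McKay, C. D. Murray, R. R. Williams, *Weak lower bounds on resource-bounded
compression imply strong separations of complexity classes*, STOC 2019, Thm. 1.2, §4
(Algorithm 1) and §5; S. Arora, B. Barak, *Computational Complexity: A Modern Approach*, CUP 2009,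
Thm. 2.18 (search from decision).
-/

namespace Summit.PneNP.PneNP.Cruxes.UniformMagnification.Birth

set_option linter.dupNamespace false -- `Summit.PneNP.PneNP.…`: summit = sub-problem (D-0017)

namespace SearchStream

open _root_.Computability
open Literature.Computability.Complexity Literature.Computability.MetaComplexity

-- BEGIN BODY

open Literature.Computability.Complexity.CircEval Literature.Computability.MetaComplexity.MCSPVerif

/-! ### The indicators -/

/-- With the live test `[· ∈ Rel]`, the core step on a query with a solution is the live state.
[folklore] -/
theorem core_eq_liveSt {g : List Bool → List Bool} {q : List Bool} (hR : boolPair q (g q) ∈ Rel) :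
    core (fun z => encodeBool (Rel.boolIndicator z)) g q = liveSt g q := by
  rw [core_apply (χ := fun z => encodeBool (Rel.boolIndicator z)) (g := g) (q := q) (b := true)
    (by show encodeBool _ = _; rw [(Set.mem_iff_boolIndicator _ _).1 hR]; rfl), if_pos rfl]

/-- With the live test `[· ∈ Rel]`, the core step on a query without a solution is the dead word.
[folklore] -/
theorem core_eq_nil {g : List Bool → List Bool} {q : List Bool} (hR : boolPair q (g q) ∉ Rel) :
    core (fun z => encodeBool (Rel.boolIndicator z)) g q = [] := by
  rw [core_apply (χ := fun z => encodeBool (Rel.boolIndicator z)) (g := g) (q := q) (b := false)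
    (by show encodeBool _ = _; rw [(Set.notMem_iff_boolIndicator _ _).1 hR]; rfl)]
  rfl

/-- With the seed test `[· ∈ Pow2L]`, the initial map on a passing seed is the core step on the
first query. [folklore] -/
theorem iota_eq_core (χ g : List Bool → List Bool) {seed : List Bool} (h : seed ∈ Pow2L) :
    iota (fun z => encodeBool (Pow2L.boolIndicator z)) χ g seed = core χ g (ssQ0 seed) := by
  rw [iota_apply (π := fun z => encodeBool (Pow2L.boolIndicator z)) (seed := seed) (b := true) χ g
    (by show encodeBool _ = _; rw [(Set.mem_iff_boolIndicator _ _).1 h]; rfl), if_pos rfl]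

/-- With the seed test `[· ∈ Pow2L]`, the initial map on a failing seed is the dead word.
[folklore] -/
theorem iota_eq_nil (χ g : List Bool → List Bool) {seed : List Bool} (h : seed ∉ Pow2L) :
    iota (fun z => encodeBool (Pow2L.boolIndicator z)) χ g seed = [] := by
  rw [iota_apply (π := fun z => encodeBool (Pow2L.boolIndicator z)) (seed := seed) (b := false) χ g
    (by show encodeBool _ = _; rw [(Set.notMem_iff_boolIndicator _ _).1 h]; rfl)]
  rfl

/-- **The seed test recognises powers of two**: the seed `⟨⟨tail (bin N), v⟩, bin N⟩` passes iff
`N = 2^{⌊log₂ N⌋}` (`|tail (bin N)| = ⌊log₂ N⌋`, `bin (2ⁿ) = 0ⁿ1`). [folklore] -/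
theorem seed_mem_Pow2L_iff (N : ℕ) (v : List Bool) :
    boolPair (boolPair (encodeNat N).tail v) (encodeNat N) ∈ Pow2L ↔ N = 2 ^ Nat.log 2 N := by
  rw [boolPair_mem_Pow2L_iff, length_tail_encodeNat]
  constructor
  · intro h
    have h' := congrArg bitsToNat h
    rw [bitsToNat_encodeNat, bitsToNat_append, bitsToNat_replicate_false, List.length_replicate] at h'
    simpa using h'
  · intro h
    conv_lhs => rw [h, Com.encodeNat_two_pow]

/-- The dead word is frozen by the whole run. [folklore] -/
theorem foldl_delta_nil (χ g : List Bool → List Bool) (x : List Bool) :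
    x.foldl (fun st b => delta χ g (boolPair st [b])) [] = [] := by
  induction x with
  | nil => rfl
  | cons b x ih => rw [List.foldl_cons, delta_nil]; exact ih

section Run

variable
  (hcomplete : ∀ (n t : ℕ) (f : (Fin n → Bool) → Bool), circuitSizeOver B2 f ≤ t →
    ∃ D : List Bool, CircEval.isClean D = true ∧
      (CircEval.tabCount D ≤ t ∧ t ≠ 0 ∨ ∃ k < n, D = CircEval.rotCode k) ∧
      (fun x : Fin n → Bool => (CircEval.evalFn (boolPair (List.ofFn x) D)).headD false) = f ∧
      D.length ≤ (t + 1) * (8 * (n + t) + 10) + 2 * n)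
  {g : List Bool → List Bool}
  (hg : ∀ q : List Bool, (∃ y : List Bool, y.length ≤ Wp.eval q.length ∧ boolPair q y ∈ Rel) →
    (g q).length ≤ Wp.eval q.length ∧ boolPair q (g q) ∈ Rel)

include hcomplete hg in
/-- **The update on a live word** is the core step: either the next live word with a good short
program extending `p ++ [b]`, or the dead word when no function of complexity `≤ t` extends
`p ++ [b]` (the length guard is transparent: live words have a fixed length).
[cite: MckayMurrayWilliams2019, §4 (Algorithm 1, proof of Thm. 1.2)] -/
theorem delta_liveWord (u v p D : List Bool) (b : Bool) (hp : p.length + 1 ≤ 2 ^ u.length)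
    (hDW : D.length ≤ Wp.eval (boolPair u v).length)
    (hext : ∀ (i : ℕ) (hi : i < p.length),
      (evalFn (boolPair (List.ofFn (lowBits u.length i)) D)).headD false = p[i]) :
    (∃ D' : List Bool,
        delta (fun z => encodeBool (Rel.boolIndicator z)) g (boolPair (liveWord u v p.length D) [b]) =
          liveWord u v (p ++ [b]).length D' ∧
        boolPair (boolPair u v) D' ∈ GoodL ∧ D'.length ≤ Wp.eval (boolPair u v).length ∧
        ∀ (i : ℕ) (hi : i < (p ++ [b]).length),
          (evalFn (boolPair (List.ofFn (lowBits u.length i)) D')).headD false = (p ++ [b])[i]) ∨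
      (delta (fun z => encodeBool (Rel.boolIndicator z)) g (boolPair (liveWord u v p.length D) [b]) = [] ∧
        ¬ ∃ f : (Fin u.length → Bool) → Bool, circuitSizeOver B2 f ≤ v.length ∧
          ∀ (i : ℕ) (hi : i < (p ++ [b]).length), f (lowBits u.length i) = (p ++ [b])[i]) := by
  have h1 : delta1 (fun z => encodeBool (Rel.boolIndicator z)) g (boolPair (liveWord u v p.length D) [b]) =
      core (fun z => encodeBool (Rel.boolIndicator z)) g (boolPair (sndP (liveWord u v p.length D)) [b]) := by
    rw [delta1_apply, head?_liveWord, if_pos rfl]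
  have hlen : (p ++ [b]).length = p.length + 1 := by simp
  rcases core_live_step hcomplete hg u v p D b hp hext _ rfl with ⟨hR, hgood, hW, hext'⟩ | ⟨hR, hnot⟩
  · left
    have hcore : core (fun z => encodeBool (Rel.boolIndicator z)) g
        (boolPair (sndP (liveWord u v p.length D)) [b]) =
        liveWord u v (p.length + 1) (g (boolPair (sndP (liveWord u v p.length D)) [b])) := by
      rw [core_eq_liveSt hR,
        liveSt_step g u v p.length D b (lt_of_le_of_lt hp (Nat.pow_lt_pow_right (by omega) (by omega)))]
    refine ⟨_, ?_, hgood, hW, hext'⟩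
    rw [hlen, delta_eq_delta1 _ _ _ _ (by rw [h1, hcore, length_liveWord _ _ _ _ hW,
      length_liveWord _ _ _ _ hDW]), h1, hcore]
  · right
    have hcore : core (fun z => encodeBool (Rel.boolIndicator z)) g
        (boolPair (sndP (liveWord u v p.length D)) [b]) = [] := core_eq_nil hR
    refine ⟨?_, hnot⟩
    rw [delta_eq_delta1 _ _ _ _ (by rw [h1, hcore]; exact Nat.zero_le _), h1, hcore]

include hcomplete hg in
/-- **The run invariant** (Nerode-type, MMW19 proof of Thm. 1.2): started on a seed `⟨⟨u, v⟩, x⟩`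
passing the power-of-two test, after a prefix `p` with `|p| ≤ 2ⁿ` the state is either the live
word at position `|p|` with a good short program whose rows `< |p|` spell `p`, or the dead word, and
then no function of complexity `≤ t` extends `p`.
[cite: MckayMurrayWilliams2019, §4 (Algorithm 1, proof of Thm. 1.2)] -/
theorem run_invariant (u v x : List Bool) (hx : boolPair (boolPair u v) x ∈ Pow2L) (p : List Bool)
    (hp : p.length ≤ 2 ^ u.length) :
    (∃ D : List Bool,
        p.foldl (fun st b => delta (fun z => encodeBool (Rel.boolIndicator z)) g (boolPair st [b]))
            (iota (fun z => encodeBool (Pow2L.boolIndicator z)) (fun z => encodeBool (Rel.boolIndicator z)) g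
              (boolPair (boolPair u v) x)) = liveWord u v p.length D ∧
        boolPair (boolPair u v) D ∈ GoodL ∧ D.length ≤ Wp.eval (boolPair u v).length ∧
        ∀ (i : ℕ) (hi : i < p.length),
          (evalFn (boolPair (List.ofFn (lowBits u.length i)) D)).headD false = p[i]) ∨
      (p.foldl (fun st b => delta (fun z => encodeBool (Rel.boolIndicator z)) g (boolPair st [b]))
            (iota (fun z => encodeBool (Pow2L.boolIndicator z)) (fun z => encodeBool (Rel.boolIndicator z)) g
              (boolPair (boolPair u v) x)) = [] ∧
        ¬ ∃ f : (Fin u.length → Bool) → Bool, circuitSizeOver B2 f ≤ v.length ∧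
          ∀ (i : ℕ) (hi : i < p.length), f (lowBits u.length i) = p[i]) := by
  induction p using List.reverseRecOn with
  | nil =>
    rw [List.foldl_nil, iota_eq_core _ _ hx]
    rcases core_init_step hcomplete hg u v x _ rfl with ⟨hR, hgood, hW⟩ | ⟨hR, hnot⟩
    · left
      refine ⟨_, ?_, hgood, hW, fun i hi => absurd hi (Nat.not_lt_zero i)⟩
      rw [core_eq_liveSt hR, liveSt_init, List.length_nil]
    · right
      refine ⟨core_eq_nil hR, ?_⟩
      rintro ⟨f, hf, -⟩
      exact hnot ⟨f, hf⟩
  | append_singleton p b ih =>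
    rw [List.length_append, List.length_singleton] at hp
    rw [List.foldl_append, List.foldl_cons, List.foldl_nil]
    rcases ih (by omega) with ⟨D, hfold, hgood, hW, hext⟩ | ⟨hfold, hnot⟩
    · rw [hfold]
      exact delta_liveWord hcomplete hg u v p D b hp hW hext
    · right
      rw [hfold, delta_nil]
      refine ⟨rfl, ?_⟩
      rintro ⟨f, hf, hfext⟩
      refine hnot ⟨f, hf, fun i hi => ?_⟩
      rw [hfext i (by rw [List.length_append]; omega), List.getElem_append_left hi]

end Run

/-- **Length of a live word is polynomial in `t ≥ n`.** [folklore] -/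
theorem length_liveWord_le (u v : List Bool) (P : ℕ) (D : List Bool)
    (hD : D.length ≤ Wp.eval (boolPair u v).length) (huv : u.length ≤ v.length) :
    (liveWord u v P D).length ≤ 250 * (v.length + 1) ^ 2 + 250 := by
  rw [length_liveWord u v P D hD, Wp_eval, length_boolPair]
  nlinarith

end SearchStream

open _root_.Computability
open Literature.Computability.Complexity Literature.Computability.MetaComplexity
open SearchStream

/-- **stub_searchStream** — MMW19 Algorithm 1 (block length 1) under the collapse: from the three clauses of
`GoodProgSpec` and `NP ⊆ P`, for every `s` with `s n ≥ n` a compressor for `MCSPSize s` with `ι, δ ∈ FP`,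
`α ∈ P` (`CompressorSpec s` unfolded; the seed of length `N` is
`⟨⟨tail (bin N), 1^{s ⌊log₂N⌋}⟩, bin N⟩`). State after a prefix `p` at arity `n = |tail (bin N)|`, `t = s n`:
`⟨[1], ⟨⟨tail (bin N), 1ᵗ⟩, ⟨takeD (n+1) (bin |p|), ⟨D, 1^{2(W-|D|)}⟩⟩⟩⟩` (`W = 8m² + 12m`, `m = 2n + 2 + t`;
dead/rejecting states are the empty word), with `D` good and its table extending `p` on rows `< |p|` (row
`j` = the assignment `lowBits n j`, the order of `truthTable`, `MCSPVerif.getElem_truthTable`); `δ` asks the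
search function `g ∈ FP` of `exists_searchFn_of_NP_subset_P` (Arora–Barak Thm 2.18) for the relation
`Rel = {⟨q, D'⟩ | |D'| ≤ W ∧ D' good ∧ ∀ w (|w| = n), (val w < P → row w of D' = row w of D) ∧ (val w = P →
row w of D' = b)}` — `Rel ∈ P` because its `∀`-part is in `∀ᵖ·P = co NP ⊆ P` under the collapse
(`co_P_holds`) — then tests `⟨q, g q⟩ ∈ Rel` (`indicatorFn_mem_FP`) to stay live or die (`iteFn`);
`α = HeadIs 1`; `ι` tests `bin N = 0ⁿ1` and runs one search with no row constraint. Correctness is the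
Nerode invariant `SearchStream.run_invariant` ("some good `D` extends `p`" live, "no function of complexity
`≤ t` extends `p`" dead); the last clause by the final length guard of `delta`, the length clause by
`n ≤ s n`. [cite: MckayMurrayWilliams2019, §4 (Algorithm 1) and §5; AroraBarakCC2009, Thm. 2.18] -/
theorem stub_searchStream
    (hsound : ∀ (n t : ℕ) (D : List Bool), CircEval.isClean D = true →
        (CircEval.tabCount D ≤ t ∧ t ≠ 0 ∨ ∃ k < n, D = CircEval.rotCode k) →
        circuitSizeOver B2
          (fun x : Fin n → Bool => (CircEval.evalFn (boolPair (List.ofFn x) D)).headD false) ≤ t)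
    (hcomplete : ∀ (n t : ℕ) (f : (Fin n → Bool) → Bool), circuitSizeOver B2 f ≤ t →
        ∃ D : List Bool, CircEval.isClean D = true ∧
          (CircEval.tabCount D ≤ t ∧ t ≠ 0 ∨ ∃ k < n, D = CircEval.rotCode k) ∧
          (fun x : Fin n → Bool => (CircEval.evalFn (boolPair (List.ofFn x) D)).headD false) = f ∧
          D.length ≤ (t + 1) * (8 * (n + t) + 10) + 2 * n)
    (hgoodP : {w : List Bool | CircEval.isClean (sndP w) = true ∧
        (CircEval.tabCount (sndP w) ≤ (sndP (fstP w)).length ∧ (sndP (fstP w)).length ≠ 0 ∨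
          ∃ k < (fstP (fstP w)).length, sndP w = CircEval.rotCode k)} ∈ Classes.P)
    (s : ℕ → ℕ) (hs : ∀ n, n ≤ s n) (hNP : Nondeterministic.NP ⊆ Classes.P) :
    ∃ (ι δ : List Bool → List Bool) (α : Language Bool), ι ∈ FP ∧ δ ∈ FP ∧ α ∈ Classes.P ∧
      (∀ x : List Bool,
        x.foldl (fun st b => δ (boolPair st [b]))
            (ι (boolPair (boolPair (encodeNat x.length).tail
              (List.replicate (s (Nat.log 2 x.length)) true)) (encodeNat x.length))) ∈ α ↔
          x ∈ MCSPSize s) ∧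
      (∃ k : ℕ, ∀ N : ℕ,
        (ι (boolPair (boolPair (encodeNat N).tail (List.replicate (s (Nat.log 2 N)) true))
          (encodeNat N))).length ≤ s (Nat.log 2 N) ^ k + k) ∧
      (∀ (st : List Bool) (b : Bool), (δ (boolPair st [b])).length ≤ st.length) := by
  have hgoodP' : GoodL ∈ Classes.P := hgoodP
  obtain ⟨g, hgFP, hg⟩ := exists_searchFn hgoodP' hNP
  have hχ : (fun z => encodeBool (Rel.boolIndicator z)) ∈ FP := relIndicator_mem_FP hgoodP' hNP
  have hπ : (fun z => encodeBool (Pow2L.boolIndicator z)) ∈ FP := indicatorFn_mem_FP Pow2L_mem_P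
  obtain ⟨c, hc⟩ := mul_succ_pow_add_le_pow_add 250 2
  refine ⟨iota (fun z => encodeBool (Pow2L.boolIndicator z)) (fun z => encodeBool (Rel.boolIndicator z)) g,
    delta (fun z => encodeBool (Rel.boolIndicator z)) g, PRelSigma.HeadIs true,
    iota_mem_FP hπ hχ hgFP, delta_mem_FP hχ hgFP, PRelSigma.HeadIs_mem_P true, fun x => ?_,
    ⟨c, fun N => ?_⟩, fun st b => length_delta_le _ _ st [b]⟩
  · -- the run decides `MCSP[s]`
    have hu : (encodeNat x.length).tail.length = Nat.log 2 x.length := length_tail_encodeNat _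
    by_cases hpow : boolPair (boolPair (encodeNat x.length).tail
        (List.replicate (s (Nat.log 2 x.length)) true)) (encodeNat x.length) ∈ Pow2L
    · have hN : x.length = 2 ^ (encodeNat x.length).tail.length := by
        rw [hu]; exact (seed_mem_Pow2L_iff _ _).1 hpow
      rcases run_invariant hcomplete hg _ _ _ hpow x hN.le with ⟨D, hfold, hgood, -, hext⟩ | ⟨hfold, hnot⟩
      · rw [hfold]
        refine ⟨fun _ => ?_, fun _ => PRelSigma.mem_HeadIs.2 (head?_liveWord _ _ _ _)⟩
        obtain ⟨hclean, hgd⟩ := (boolPair_mem_GoodL_iff _ _ _).1 hgood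
        rw [List.length_replicate, hu] at hgd
        refine ⟨(encodeNat x.length).tail.length, fun y =>
          (CircEval.evalFn (boolPair (List.ofFn y) D)).headD false, ?_, ?_⟩
        · refine List.ext_getElem (by rw [length_truthTable, ← hN]) fun i h1 h2 => ?_
          rw [MCSPVerif.getElem_truthTable, hext i h1]
        · rw [hu]
          exact hsound _ _ D hclean hgd
      · rw [hfold]
        refine ⟨fun h => absurd (PRelSigma.mem_HeadIs.1 h) (by simp), fun h => ?_⟩
        obtain ⟨m, f, hxf, hf⟩ := h
        exfalso
        have hm : m = (encodeNat x.length).tail.length := by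
          have h1 : x.length = 2 ^ m := by rw [hxf, length_truthTable]
          exact Nat.pow_right_injective le_rfl (h1.symm.trans hN)
        subst hm
        refine hnot ⟨f, ?_, fun i hi => ?_⟩
        · rw [List.length_replicate, ← hu]; exact hf
        · rw [List.getElem_of_eq hxf hi, MCSPVerif.getElem_truthTable]
    · have hι : iota (fun z => encodeBool (Pow2L.boolIndicator z)) (fun z => encodeBool (Rel.boolIndicator z)) g
          (boolPair (boolPair (encodeNat x.length).tail (List.replicate (s (Nat.log 2 x.length)) true))
            (encodeNat x.length)) = [] := iota_eq_nil _ _ hpow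
      rw [hι, foldl_delta_nil]
      refine ⟨fun h => absurd (PRelSigma.mem_HeadIs.1 h) (by simp), fun h => ?_⟩
      obtain ⟨m, f, hxf, hf⟩ := h
      exfalso
      refine hpow ((seed_mem_Pow2L_iff _ _).2 ?_)
      rw [hxf, length_truthTable, Nat.log_pow one_lt_two]
  · -- the initial state is short
    by_cases hpow : boolPair (boolPair (encodeNat N).tail (List.replicate (s (Nat.log 2 N)) true))
        (encodeNat N) ∈ Pow2L
    · rw [iota_eq_core _ _ hpow]
      rcases core_init_step hcomplete hg (encodeNat N).tail (List.replicate (s (Nat.log 2 N)) true)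
        (encodeNat N) _ rfl with ⟨hR, -, hW⟩ | ⟨hR, -⟩
      · rw [core_eq_liveSt hR, liveSt_init]
        refine (length_liveWord_le _ _ _ _ hW ?_).trans ?_
        · rw [List.length_replicate, length_tail_encodeNat]; exact hs _
        · rw [List.length_replicate]; exact hc _
      · rw [core_eq_nil hR]
        exact Nat.zero_le _
    · rw [iota_eq_nil _ _ hpow]
      exact Nat.zero_le _

end Summit.PneNP.PneNP.Cruxes.UniformMagnification.Birth
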